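import Literature.Analysis.Fourier.RadialSchwartzInterpolationGaussian
import Mathlib.Analysis.Calculus.ParametricIntegral
import Mathlib.MeasureTheory.Integral.Prod
import HarnessLib

/-!
# CKMRV interpolation, step 2: superpositions of complex Gaussians along a line `Im τ = y`

Sibling of `Literature/Analysis/Fourier/RadialSchwartzInterpolation.lean` (the named fact
`CKMRV2022_interpolationFormula` = Cohn–Kumar–Miller–Radchenko–Viazovska, Ann. Math. 196 (2022),
Theorem 1.7) and of `RadialSchwartzInterpolationGaussian.lean` (step 1). In the proof of CKMRV
Lemma 2.2 (density of complex Gaussians in `𝓢_rad(ℝᵈ)`) a radial function is written as a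
**superposition of complex Gaussians along the horizontal line `τ = 2t + iy`**:
"`f(x) = lim_{T → ∞} ∫_{-T}^{T} ĝ(t) e^{πi(2t+iy)|x|²} dt`". This file sets up such
superpositions `S_w(x) = ∫ w(t) e^{πi(2t+iy)|x|²} dt` for an integrable weight `w` (`gaussSup`)
and computes, with proofs, the four kinds of data entering the interpolation formula (1.4):

* values `S_w(r) = ∫ w(t) e^{πiτ(t)r²} dt` (`radialValue_gaussSup`);
* radial derivatives `S_w′(r) = ∫ w(t) 2πiτ(t) r e^{πiτ(t)r²} dt`, by differentiation under the
  integral sign (`hasDerivAt_radial_gaussSup`, `radialDeriv_gaussSup`; needs `∫ |t| |w(t)| dt < ∞`);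
* the Fourier transform `Ŝ_w(ξ) = ∫ w(t) (i/τ(t))^{d/2} e^{πi(−1/τ(t))|ξ|²} dt`, by Fubini and
  the Fourier transform of a single complex Gaussian (`fourier_gaussSup`);
* radial derivatives of `Ŝ_w`, again under the integral sign (`radialDeriv_fourier_gaussSup`).

Here `τ(t) = 2t + iy` (`lineH y t`), `y > 0`. Everything is proved; no named facts. Used by the
density-free form of the last step of the proof of CKMRV Theorem 3.1 (interpolation formula for
Gaussian superpositions, then for all radial Schwartz functions).

## References

* H. Cohn, A. Kumar, S. D. Miller, D. Radchenko, M. Viazovska, *Universal optimality of the `E₈`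
  and Leech lattices and interpolation formulas*, Ann. of Math. 196 (2022) 983–1082,
  arXiv:1902.05438: §2.3 Lemma 2.2 (proof), §1.5, §3.1. [CohnEtAl2019]
-/

noncomputable section

open scoped SchwartzMap FourierTransform Topology UpperHalfPlane ContDiff RealInnerProductSpace
open Filter Complex MeasureTheory Set Metric

namespace Literature.Analysis.Fourier

/-! ## The line `τ = 2t + iy` -/

/-- The point `τ(t) = 2t + iy` of the horizontal line `Im τ = y` (CKMRV, proof of Lemma 2.2:
"complex Gaussians with `τ = 2t + iy` for different values of `t` in `ℝ`"). [cite: CohnEtAl2019, §2.3 Lemma 2.2] -/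
def lineH (y t : ℝ) : ℂ := 2 * (t : ℂ) + (y : ℂ) * I

/-- `Im τ(t) = y`. [folklore] -/
@[simp] theorem lineH_im (y t : ℝ) : (lineH y t).im = y := by simp [lineH]

/-- `Re τ(t) = 2t`. [folklore] -/
@[simp] theorem lineH_re (y t : ℝ) : (lineH y t).re = 2 * t := by simp [lineH]

/-- `|τ(t)| ≤ 2|t| + |y|`. [folklore] -/
theorem norm_lineH_le (y t : ℝ) : ‖lineH y t‖ ≤ 2 * |t| + |y| := by
  unfold lineH
  refine (norm_add_le _ _).trans ?_
  simp [Complex.norm_real, Real.norm_eq_abs]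

/-- `y ≤ |τ(t)|` (the imaginary part bounds the modulus from below). [folklore] -/
theorem le_norm_lineH {y : ℝ} (hy : 0 ≤ y) (t : ℝ) : y ≤ ‖lineH y t‖ := by
  have h := Complex.abs_im_le_norm (lineH y t)
  rwa [lineH_im, abs_of_nonneg hy] at h

/-- `τ(t) ≠ 0` for `y ≠ 0`. [folklore] -/
theorem lineH_ne_zero {y : ℝ} (hy : y ≠ 0) (t : ℝ) : lineH y t ≠ 0 := fun h => by
  have := congrArg Complex.im h
  simp [hy] at this

/-- `t ↦ τ(t)` is continuous. [folklore] -/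
@[fun_prop]
theorem continuous_lineH (y : ℝ) : Continuous fun t : ℝ => lineH y t := by
  unfold lineH; fun_prop

/-- The point `τ(t) = 2t + iy` of `ℍ` for `y > 0`. [cite: CohnEtAl2019, §2.3 Lemma 2.2] -/
def lineHPt (y : ℝ) (hy : 0 < y) (t : ℝ) : ℍ :=
  UpperHalfPlane.mk (lineH y t) (by rwa [lineH_im])

/-- `↑τ(t) = 2t + iy`. [folklore] -/
@[simp] theorem coe_lineHPt (y : ℝ) (hy : 0 < y) (t : ℝ) : (lineHPt y hy t : ℂ) = lineH y t := rfl

/-- `i/τ(t)` lies in the slit plane (its real part `y/|τ|²` is positive) for `y > 0`. [folklore] -/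
theorem I_div_lineH_mem_slitPlane {y : ℝ} (hy : 0 < y) (t : ℝ) : I / lineH y t ∈ slitPlane := by
  left
  simp only [Complex.div_re, Complex.I_re, Complex.I_im, zero_mul, one_mul, zero_div, zero_add,
    lineH_im]
  exact div_pos hy (Complex.normSq_pos.2 (lineH_ne_zero hy.ne' t))

/-! ## Norms of complex Gaussians -/

/-- `|e^{πiτs}| = e^{−π Im(τ) s}` for real `s`. [folklore] -/
theorem norm_cexp_pi_I_mul (τ : ℂ) (s : ℝ) :
    ‖cexp (Real.pi * I * τ * (s : ℂ))‖ = Real.exp (-Real.pi * τ.im * s) := by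
  rw [Complex.norm_exp]
  congr 1
  simp [Complex.mul_re, Complex.mul_im]

/-- `|e^{πiτs}| ≤ 1` for `Im τ ≥ 0`, `s ≥ 0`. [folklore] -/
theorem norm_cexp_pi_I_mul_le_one {τ : ℂ} (hτ : 0 ≤ τ.im) {s : ℝ} (hs : 0 ≤ s) :
    ‖cexp (Real.pi * I * τ * (s : ℂ))‖ ≤ 1 := by
  rw [norm_cexp_pi_I_mul, Real.exp_le_one_iff]
  have := Real.pi_pos.le
  nlinarith [mul_nonneg (mul_nonneg this hτ) hs]

/-- `|e^{πiτ|x|²}| = e^{−π Im τ |x|²}`. [folklore] -/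
theorem norm_cexp_pi_I_mul_norm_sq {V : Type*} [SeminormedAddCommGroup V] (τ : ℂ) (x : V) :
    ‖cexp (Real.pi * I * τ * ‖x‖ ^ 2)‖ = Real.exp (-Real.pi * τ.im * ‖x‖ ^ 2) := by
  have h := norm_cexp_pi_I_mul τ (‖x‖ ^ 2)
  simpa using h

/-- `|e^{πiτ|x|²}| ≤ 1` for `Im τ ≥ 0`. [folklore] -/
theorem norm_cexp_pi_I_mul_norm_sq_le_one {V : Type*} [SeminormedAddCommGroup V] {τ : ℂ}
    (hτ : 0 ≤ τ.im) (x : V) : ‖cexp (Real.pi * I * τ * ‖x‖ ^ 2)‖ ≤ 1 := by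
  have h := norm_cexp_pi_I_mul_le_one hτ (sq_nonneg ‖x‖)
  simpa using h

/-- `‖(i/τ)^{c}‖ = (1/|τ|)^{c}` for real `c` (principal branch). [folklore] -/
theorem norm_I_div_cpow (τ : ℂ) (c : ℝ) : ‖(I / τ) ^ (c : ℂ)‖ = ‖τ‖⁻¹ ^ c := by
  rw [Complex.norm_cpow_real, norm_div, Complex.norm_I, one_div]

/-- `‖(i/τ(t))^{c}‖ ≤ y^{-c}` along the line `Im τ = y > 0`, for `c ≥ 0`. [folklore] -/
theorem norm_I_div_lineH_cpow_le {y : ℝ} (hy : 0 < y) {c : ℝ} (hc : 0 ≤ c) (t : ℝ) :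
    ‖(I / lineH y t) ^ (c : ℂ)‖ ≤ y⁻¹ ^ c := by
  rw [norm_I_div_cpow]
  exact Real.rpow_le_rpow (inv_nonneg.2 (norm_nonneg _))
    ((inv_le_inv₀ (lt_of_lt_of_le hy (le_norm_lineH hy.le t)) hy).2 (le_norm_lineH hy.le t)) hc

/-- `Im(−1/τ) ≥ 0` for `Im τ ≥ 0`. [folklore] -/
theorem neg_inv_im_nonneg {τ : ℂ} (hτ : 0 ≤ τ.im) : 0 ≤ (-τ⁻¹).im := by
  simp only [Complex.neg_im, Complex.inv_im, neg_div, neg_neg]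
  exact div_nonneg hτ (Complex.normSq_nonneg _)

/-- `‖1/τ(t)‖ ≤ 1/y` along the line. [folklore] -/
theorem norm_inv_lineH_le {y : ℝ} (hy : 0 < y) (t : ℝ) : ‖(lineH y t)⁻¹‖ ≤ y⁻¹ := by
  rw [norm_inv]
  exact (inv_le_inv₀ (lt_of_lt_of_le hy (le_norm_lineH hy.le t)) hy).2 (le_norm_lineH hy.le t)

/-- On the ball `|r − r₀| < 1`, `|r| ≤ |r₀| + 1`. [folklore] -/
theorem abs_le_abs_add_one_of_mem_ball {r₀ r : ℝ} (hr : r ∈ ball r₀ 1) : |r| ≤ |r₀| + 1 := by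
  have h1 : |r - r₀| < 1 := by simpa [Real.dist_eq] using hr
  have h2 := abs_sub_abs_le_abs_sub r r₀
  linarith

/-! ## Gaussian superpositions `S_w(x) = ∫ w(t) e^{πi(2t+iy)|x|²} dt` -/

section Superposition

variable {V : Type*} [SeminormedAddCommGroup V]

/-- The **Gaussian superposition** `S_w(x) = ∫ w(t) e^{πi(2t+iy)|x|²} dt` with weight `w` along the
line `Im τ = y` (CKMRV, proof of Lemma 2.2: `x ↦ ∫ ĝ(t) e^{πi(2t+iy)|x|²} dt`). [cite: CohnEtAl2019, §2.3 Lemma 2.2] -/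
def gaussSup (w : ℝ → ℂ) (y : ℝ) (x : V) : ℂ :=
  ∫ t : ℝ, w t * cexp (Real.pi * I * lineH y t * ‖x‖ ^ 2)

/-- `gaussSup` unfolds. [cite: CohnEtAl2019, §2.3 Lemma 2.2] -/
theorem gaussSup_def (w : ℝ → ℂ) (y : ℝ) (x : V) :
    gaussSup w y x = ∫ t : ℝ, w t * cexp (Real.pi * I * lineH y t * ‖x‖ ^ 2) := rfl

/-- A Gaussian superposition is radial. [folklore] -/
theorem isRadial_gaussSup (w : ℝ → ℂ) (y : ℝ) : IsRadial (gaussSup w y : V → ℂ) := by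
  intro x x' h
  simp only [gaussSup_def, h]

end Superposition

/-- The integrand of a Gaussian superposition is integrable in `t` (for `y ≥ 0`, integrable `w`,
`s ≥ 0` in place of `|x|²`). [folklore] -/
theorem integrable_gaussSup_integrand {w : ℝ → ℂ} (hw : Integrable w) {y : ℝ} (hy : 0 ≤ y)
    {s : ℝ} (hs : 0 ≤ s) :
    Integrable fun t : ℝ => w t * cexp (Real.pi * I * lineH y t * (s : ℂ)) := by
  refine hw.mul_bdd (c := 1) ?_ (Eventually.of_forall fun t => ?_)
  · exact (by fun_prop : Continuous fun t : ℝ =>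
      cexp ((Real.pi : ℂ) * I * lineH y t * (s : ℂ))).aestronglyMeasurable
  · exact norm_cexp_pi_I_mul_le_one (by simp [hy]) hs

section Euclidean

variable {d : ℕ} [NeZero d]

/-- **Values** of a Gaussian superposition: `S_w(r) = ∫ w(t) e^{πiτ(t)r²} dt`. [cite: CohnEtAl2019, §2.3 Lemma 2.2] -/
theorem radialValue_gaussSup (w : ℝ → ℂ) (y r : ℝ) :
    radialValue (gaussSup w y : EuclideanSpace ℝ (Fin d) → ℂ) r =
      ∫ t : ℝ, w t * cexp (Real.pi * I * lineH y t * (r : ℂ) ^ 2) := by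
  rw [radialValue_def, gaussSup_def, norm_axisPt]
  congr 1
  funext t
  congr 2
  norm_cast
  rw [sq_abs]

/-- Along the axis, a Gaussian superposition is the one-variable `r ↦ ∫ w(t) e^{πiτ(t)r²} dt`.
[folklore] -/
theorem gaussSup_axisPt (w : ℝ → ℂ) (y : ℝ) :
    (fun r : ℝ => gaussSup w y (axisPt d r)) =
      fun r : ℝ => ∫ t : ℝ, w t * cexp (Real.pi * I * lineH y t * (r : ℂ) ^ 2) :=
  funext fun r => radialValue_gaussSup w y r

/-- **Differentiation under the integral sign** for `r ↦ ∫ w(t) e^{πiτ(t)r²} dt`: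
the derivative is `∫ w(t) 2πiτ(t) r e^{πiτ(t)r²} dt`, provided `w` and `t w(t)` are integrable and
`y ≥ 0` (the `r`-derivative of the integrand is bounded on `|r − r₀| < 1` by
`|w(t)| · 2π(2|t|+|y|)(|r₀|+1)`). [folklore] -/
theorem hasDerivAt_radial_gaussSup {w : ℝ → ℂ} (hw : Integrable w)
    (hw1 : Integrable fun t : ℝ => (t : ℂ) * w t) {y : ℝ} (hy : 0 ≤ y) (r₀ : ℝ) :
    Integrable (fun t : ℝ => w t * (2 * Real.pi * I * lineH y t * r₀ *
        cexp (Real.pi * I * lineH y t * (r₀ : ℂ) ^ 2))) ∧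
    HasDerivAt (fun r : ℝ => ∫ t : ℝ, w t * cexp (Real.pi * I * lineH y t * (r : ℂ) ^ 2))
      (∫ t : ℝ, w t * (2 * Real.pi * I * lineH y t * r₀ * cexp (Real.pi * I * lineH y t * (r₀ : ℂ) ^ 2)))
      r₀ := by
  set F : ℝ → ℝ → ℂ := fun r t => w t * cexp (Real.pi * I * lineH y t * (r : ℂ) ^ 2) with hF
  set F' : ℝ → ℝ → ℂ := fun r t =>
    w t * (2 * Real.pi * I * lineH y t * r * cexp (Real.pi * I * lineH y t * (r : ℂ) ^ 2)) with hF'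
  set bound : ℝ → ℝ := fun t => ‖w t‖ * (2 * Real.pi * (2 * |t| + |y|) * (|r₀| + 1)) with hbound
  have hcontF : ∀ r : ℝ, Continuous fun t : ℝ => cexp (Real.pi * I * lineH y t * (r : ℂ) ^ 2) :=
    fun r => by fun_prop
  have hcontF' : ∀ r : ℝ, Continuous fun t : ℝ =>
      2 * Real.pi * I * lineH y t * r * cexp (Real.pi * I * lineH y t * (r : ℂ) ^ 2) := fun r => by
    fun_prop
  have hmeas : ∀ r : ℝ, AEStronglyMeasurable (F r) volume := fun r =>
    hw.aestronglyMeasurable.mul (hcontF r).aestronglyMeasurable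
  have hint : Integrable (F r₀) volume := by
    have h := integrable_gaussSup_integrand hw hy (sq_nonneg r₀)
    refine h.congr (Eventually.of_forall fun t => ?_)
    simp only [hF]
    push_cast
    rfl
  have hF'meas : AEStronglyMeasurable (F' r₀) volume :=
    hw.aestronglyMeasurable.mul (hcontF' r₀).aestronglyMeasurable
  have hbound_int : Integrable bound volume := by
    have h1 : Integrable (fun t : ℝ => ‖w t‖ * |t|) volume := by
      refine hw1.norm.congr (Eventually.of_forall fun t => ?_)
      simp [mul_comm]
    have h2 : Integrable (fun t : ℝ => ‖w t‖) volume := hw.norm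
    have : bound = fun t => (2 * Real.pi * 2 * (|r₀| + 1)) * (‖w t‖ * |t|) +
        (2 * Real.pi * |y| * (|r₀| + 1)) * ‖w t‖ := by
      funext t; simp only [hbound]; ring
    rw [this]
    exact (h1.const_mul _).add (h2.const_mul _)
  have h_bound : ∀ᵐ t ∂volume, ∀ r ∈ ball r₀ 1, ‖F' r t‖ ≤ bound t := by
    refine Eventually.of_forall fun t r hr => ?_
    have e1 : ‖cexp (Real.pi * I * lineH y t * (r : ℂ) ^ 2)‖ ≤ 1 := by
      have := norm_cexp_pi_I_mul_le_one (τ := lineH y t) (by simp [hy]) (sq_nonneg r)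
      simpa using this
    have e2 : ‖(2 : ℂ) * Real.pi * I * lineH y t * r‖ ≤ 2 * Real.pi * (2 * |t| + |y|) * (|r₀| + 1) := by
      rw [norm_mul, norm_mul, norm_mul, norm_mul]
      simp only [Complex.norm_ofNat, Complex.norm_real, Real.norm_eq_abs,
        abs_of_pos Real.pi_pos, Complex.norm_I, mul_one]
      gcongr
      · exact norm_lineH_le y t
      · exact abs_le_abs_add_one_of_mem_ball hr
    show ‖w t * (2 * Real.pi * I * lineH y t * r * cexp (Real.pi * I * lineH y t * (r : ℂ) ^ 2))‖ ≤
      ‖w t‖ * (2 * Real.pi * (2 * |t| + |y|) * (|r₀| + 1))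
    rw [norm_mul, norm_mul]
    refine mul_le_mul_of_nonneg_left ?_ (norm_nonneg _)
    calc ‖(2 : ℂ) * Real.pi * I * lineH y t * r‖ * ‖cexp (Real.pi * I * lineH y t * (r : ℂ) ^ 2)‖
        ≤ 2 * Real.pi * (2 * |t| + |y|) * (|r₀| + 1) * 1 :=
          mul_le_mul e2 e1 (norm_nonneg _) (by positivity)
      _ = _ := mul_one _
  have h_diff : ∀ᵐ t ∂volume, ∀ r ∈ ball r₀ 1, HasDerivAt (F · t) (F' r t) r := by
    refine Eventually.of_forall fun t r _ => ?_
    simp only [hF, hF']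
    have h := (hasDerivAt_cexp_quadratic (Real.pi * I * lineH y t) r).const_mul (w t)
    refine h.congr_deriv ?_
    ring
  exact hasDerivAt_integral_of_dominated_loc_of_deriv_le (ball_mem_nhds r₀ one_pos)
    (Eventually.of_forall hmeas) hint hF'meas h_bound hbound_int h_diff

/-- **Radial derivatives** of a Gaussian superposition: `S_w′(r) = ∫ w(t) 2πiτ(t) r e^{πiτ(t)r²} dt`
(differentiation under the integral sign). [cite: CohnEtAl2019, §2.3 Lemma 2.2] -/
theorem radialDeriv_gaussSup {w : ℝ → ℂ} (hw : Integrable w)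
    (hw1 : Integrable fun t : ℝ => (t : ℂ) * w t) {y : ℝ} (hy : 0 ≤ y) (r : ℝ) :
    radialDeriv (gaussSup w y : EuclideanSpace ℝ (Fin d) → ℂ) r =
      ∫ t : ℝ, w t * (2 * Real.pi * I * lineH y t * r * cexp (Real.pi * I * lineH y t * (r : ℂ) ^ 2)) := by
  rw [radialDeriv_def, gaussSup_axisPt, (hasDerivAt_radial_gaussSup hw hw1 hy r).2.deriv]

end Euclidean

/-! ## The Fourier transform of a Gaussian superposition -/

section Fourier

variable {E : Type*} [NormedAddCommGroup E] [InnerProductSpace ℝ E] [FiniteDimensional ℝ E]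
  [MeasurableSpace E] [BorelSpace E]

/-- Function-level Fourier transform of a single complex Gaussian:
`𝓕(e^{πiτ|·|²})(ξ) = (i/τ)^{dim E/2} e^{πi(−1/τ)|ξ|²}`. [cite: CohnEtAl2019, §1.5] -/
theorem fourier_cexp_pi_I_mul_norm_sq (τ : ℍ) (ξ : E) :
    𝓕 (fun x : E => cexp (Real.pi * I * (τ : ℂ) * ‖x‖ ^ 2)) ξ =
      (I / (τ : ℂ)) ^ ((Module.finrank ℝ E : ℂ) / 2) * cexp (Real.pi * I * (-(τ : ℂ)⁻¹) * ‖ξ‖ ^ 2) := by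
  rw [← coe_complexGaussian, ← SchwartzMap.fourier_coe, fourier_complexGaussian_apply,
    complexGaussian_apply, UpperHalfPlane.coe_negInv]

/-- The real Gaussian `e^{−πy|x|²}`, `y > 0`, is integrable on a finite-dimensional inner product
space. [folklore] -/
theorem integrable_exp_neg_pi_mul_norm_sq {y : ℝ} (hy : 0 < y) :
    Integrable fun x : E => Real.exp (-Real.pi * y * ‖x‖ ^ 2) := by
  have h := ((complexGaussian E (lineHPt y hy 0)).integrable (μ := volume)).norm
  refine h.congr (Eventually.of_forall fun x => ?_)
  show ‖complexGaussian E (lineHPt y hy 0) x‖ = Real.exp (-Real.pi * y * ‖x‖ ^ 2)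
  rw [complexGaussian_apply, coe_lineHPt, norm_cexp_pi_I_mul_norm_sq, lineH_im]

/-- The integrand `(x, t) ↦ e^{−2πi⟨x,ξ⟩} w(t) e^{πiτ(t)|x|²}` of `Ŝ_w(ξ)` is integrable on
`E × ℝ` (its norm is `|w(t)| e^{−πy|x|²}`). [folklore] -/
theorem integrable_gaussSup_fourier_integrand {w : ℝ → ℂ} (hw : Integrable w) {y : ℝ} (hy : 0 < y)
    (ξ : E) :
    Integrable (Function.uncurry fun (x : E) (t : ℝ) =>
      cexp ((↑(-2 * Real.pi * ⟪x, ξ⟫) : ℂ) * I) • (w t * cexp (Real.pi * I * lineH y t * ‖x‖ ^ 2)))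
      ((volume : Measure E).prod (volume : Measure ℝ)) := by
  have hprod : Integrable (fun z : E × ℝ => Real.exp (-Real.pi * y * ‖z.1‖ ^ 2) * ‖w z.2‖)
      ((volume : Measure E).prod (volume : Measure ℝ)) :=
    (integrable_exp_neg_pi_mul_norm_sq (E := E) hy).mul_prod hw.norm
  refine hprod.mono' ?_ (Eventually.of_forall fun z => ?_)
  · have h1 : AEStronglyMeasurable (fun z : E × ℝ =>
        (cexp ((↑(-2 * Real.pi * ⟪z.1, ξ⟫) : ℂ) * I) * cexp (Real.pi * I * lineH y z.2 * ‖z.1‖ ^ 2)) *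
          w z.2) ((volume : Measure E).prod (volume : Measure ℝ)) :=
      (by fun_prop : Continuous fun z : E × ℝ => cexp ((↑(-2 * Real.pi * ⟪z.1, ξ⟫) : ℂ) * I) *
          cexp (Real.pi * I * lineH y z.2 * ‖z.1‖ ^ 2)).aestronglyMeasurable.mul
        hw.aestronglyMeasurable.comp_snd
    refine h1.congr (Eventually.of_forall fun z => ?_)
    obtain ⟨x, t⟩ := z
    simp only [Function.uncurry_apply_pair, smul_eq_mul]
    ring
  · rcases z with ⟨x, t⟩
    simp only [Function.uncurry_apply_pair, norm_smul, norm_mul, Complex.norm_exp_ofReal_mul_I,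
      one_mul, norm_cexp_pi_I_mul_norm_sq, lineH_im]
    rw [mul_comm]

/-- **Fourier transform of a Gaussian superposition** (Fubini + the single-Gaussian formula):
`Ŝ_w(ξ) = ∫ w(t) (i/τ(t))^{dim E/2} e^{πi(−1/τ(t))|ξ|²} dt` for integrable `w`, `y > 0`.
[cite: CohnEtAl2019, §2.3 Lemma 2.2 and §1.5] -/
theorem fourier_gaussSup {w : ℝ → ℂ} (hw : Integrable w) {y : ℝ} (hy : 0 < y) (ξ : E) :
    𝓕 (gaussSup w y : E → ℂ) ξ = ∫ t : ℝ, w t * ((I / lineH y t) ^ ((Module.finrank ℝ E : ℂ) / 2) *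
      cexp (Real.pi * I * (-(lineH y t)⁻¹) * ‖ξ‖ ^ 2)) := by
  rw [Real.fourier_eq']
  simp only [gaussSup_def]
  have hswap := integral_integral_swap (integrable_gaussSup_fourier_integrand hw hy ξ)
  rw [show (∫ v : E, cexp ((↑(-2 * Real.pi * ⟪v, ξ⟫) : ℂ) * I) •
      ∫ t : ℝ, w t * cexp (Real.pi * I * lineH y t * ‖v‖ ^ 2)) =
      ∫ v : E, ∫ t : ℝ, cexp ((↑(-2 * Real.pi * ⟪v, ξ⟫) : ℂ) * I) •
        (w t * cexp (Real.pi * I * lineH y t * ‖v‖ ^ 2)) from by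
    congr 1; funext v; rw [← integral_smul]]
  rw [hswap]
  congr 1
  funext t
  have hG := fourier_cexp_pi_I_mul_norm_sq (E := E) (lineHPt y hy t) ξ
  rw [Real.fourier_eq', coe_lineHPt] at hG
  rw [← hG, ← integral_const_mul]
  congr 1
  funext v
  simp only [smul_eq_mul]
  ring

end Fourier

/-! ## Radial derivatives of the Fourier transform -/

section EuclideanFourier

variable {d : ℕ} [NeZero d]

/-- `Ŝ_w` on `ℝᵈ` along the axis: `r ↦ ∫ w(t) (i/τ(t))^{d/2} e^{πi(−1/τ(t))r²} dt`. [folklore] -/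
theorem fourier_gaussSup_axisPt {w : ℝ → ℂ} (hw : Integrable w) {y : ℝ} (hy : 0 < y) :
    (fun r : ℝ => 𝓕 (gaussSup w y : EuclideanSpace ℝ (Fin d) → ℂ) (axisPt d r)) =
      fun r : ℝ => ∫ t : ℝ, w t * ((I / lineH y t) ^ ((d : ℂ) / 2) *
        cexp (Real.pi * I * (-(lineH y t)⁻¹) * (r : ℂ) ^ 2)) := by
  funext r
  rw [fourier_gaussSup hw hy, finrank_euclideanSpace_fin, norm_axisPt]
  congr 1
  funext t
  congr 3
  norm_cast
  rw [sq_abs]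

/-- **Values of `Ŝ_w`**: `Ŝ_w(r) = ∫ w(t) (i/τ(t))^{d/2} e^{πi(−1/τ(t))r²} dt`. [cite: CohnEtAl2019, §2.3 Lemma 2.2] -/
theorem radialValue_fourier_gaussSup {w : ℝ → ℂ} (hw : Integrable w) {y : ℝ} (hy : 0 < y) (r : ℝ) :
    radialValue (𝓕 (gaussSup w y : EuclideanSpace ℝ (Fin d) → ℂ)) r =
      ∫ t : ℝ, w t * ((I / lineH y t) ^ ((d : ℂ) / 2) *
        cexp (Real.pi * I * (-(lineH y t)⁻¹) * (r : ℂ) ^ 2)) := by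
  rw [radialValue_def]
  exact congrFun (fourier_gaussSup_axisPt hw hy) r

omit [NeZero d] in
/-- Differentiation under the integral sign for `r ↦ ∫ w(t) (i/τ)^{d/2} e^{πi(−1/τ)r²} dt`:
the derivative is `∫ w(t) (i/τ)^{d/2} 2πi(−1/τ) r e^{πi(−1/τ)r²} dt` (integrable `w`, `y > 0`; the
integrand's `r`-derivative is bounded by `|w(t)| y^{−d/2} (2π/y)(|r₀|+1)`). [folklore] -/
theorem hasDerivAt_radial_fourier_gaussSup {w : ℝ → ℂ} (hw : Integrable w) {y : ℝ} (hy : 0 < y)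
    (r₀ : ℝ) :
    Integrable (fun t : ℝ => w t * ((I / lineH y t) ^ ((d : ℂ) / 2) *
        (2 * Real.pi * I * (-(lineH y t)⁻¹) * r₀ * cexp (Real.pi * I * (-(lineH y t)⁻¹) * (r₀ : ℂ) ^ 2)))) ∧
    HasDerivAt (fun r : ℝ => ∫ t : ℝ, w t * ((I / lineH y t) ^ ((d : ℂ) / 2) *
        cexp (Real.pi * I * (-(lineH y t)⁻¹) * (r : ℂ) ^ 2)))
      (∫ t : ℝ, w t * ((I / lineH y t) ^ ((d : ℂ) / 2) *
        (2 * Real.pi * I * (-(lineH y t)⁻¹) * r₀ * cexp (Real.pi * I * (-(lineH y t)⁻¹) * (r₀ : ℂ) ^ 2))))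
      r₀ := by
  have hy0 : y ≠ 0 := hy.ne'
  set c : ℝ → ℂ := fun t => (I / lineH y t) ^ ((d : ℂ) / 2) with hc
  set σ : ℝ → ℂ := fun t => -(lineH y t)⁻¹ with hσ
  set F : ℝ → ℝ → ℂ := fun r t => w t * (c t * cexp (Real.pi * I * σ t * (r : ℂ) ^ 2)) with hF
  set F' : ℝ → ℝ → ℂ := fun r t =>
    w t * (c t * (2 * Real.pi * I * σ t * r * cexp (Real.pi * I * σ t * (r : ℂ) ^ 2))) with hF'
  set K : ℝ := y⁻¹ ^ ((d : ℝ) / 2) * (2 * Real.pi * y⁻¹ * (|r₀| + 1)) with hK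
  set bound : ℝ → ℝ := fun t => ‖w t‖ * K with hbound
  have hσcont : Continuous σ := by
    simp only [hσ]
    exact ((continuous_lineH y).inv₀ (lineH_ne_zero hy0)).neg
  have hccont : Continuous c := by
    simp only [hc]
    have hd : ((d : ℂ) / 2) = (((d : ℝ) / 2 : ℝ) : ℂ) := by push_cast; ring
    exact Continuous.cpow (continuous_const.div (continuous_lineH y) (lineH_ne_zero hy0))
      continuous_const (fun t => I_div_lineH_mem_slitPlane hy t)
  have hσim : ∀ t, 0 ≤ (σ t).im := fun t => neg_inv_im_nonneg (by simp [hy.le])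
  have hnc : ∀ t, ‖c t‖ ≤ y⁻¹ ^ ((d : ℝ) / 2) := fun t => by
    have h := norm_I_div_lineH_cpow_le hy (c := (d : ℝ) / 2) (by positivity) t
    have hd : ((d : ℂ) / 2) = (((d : ℝ) / 2 : ℝ) : ℂ) := by push_cast; ring
    simp only [hc, hd]
    exact h
  have hnσ : ∀ t, ‖σ t‖ ≤ y⁻¹ := fun t => by
    simp only [hσ, norm_neg]
    exact norm_inv_lineH_le hy t
  have hcontF : ∀ r : ℝ, Continuous fun t : ℝ => c t * cexp (Real.pi * I * σ t * (r : ℂ) ^ 2) :=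
    fun r => by fun_prop
  have hcontF' : ∀ r : ℝ, Continuous fun t : ℝ =>
      c t * (2 * Real.pi * I * σ t * r * cexp (Real.pi * I * σ t * (r : ℂ) ^ 2)) := fun r => by
    fun_prop
  have e1 : ∀ (t r : ℝ), ‖cexp (Real.pi * I * σ t * (r : ℂ) ^ 2)‖ ≤ 1 := fun t r => by
    have := norm_cexp_pi_I_mul_le_one (hσim t) (sq_nonneg r)
    simpa using this
  have hmeas : ∀ r : ℝ, AEStronglyMeasurable (F r) volume := fun r =>
    hw.aestronglyMeasurable.mul (hcontF r).aestronglyMeasurable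
  have hint : ∀ r : ℝ, Integrable (F r) volume := fun r => by
    refine hw.mul_bdd (c := y⁻¹ ^ ((d : ℝ) / 2)) (hcontF r).aestronglyMeasurable
      (Eventually.of_forall fun t => ?_)
    rw [norm_mul]
    calc ‖c t‖ * ‖cexp (Real.pi * I * σ t * (r : ℂ) ^ 2)‖ ≤ y⁻¹ ^ ((d : ℝ) / 2) * 1 :=
          mul_le_mul (hnc t) (e1 t r) (norm_nonneg _) (by positivity)
      _ = _ := mul_one _
  have hF'meas : AEStronglyMeasurable (F' r₀) volume :=
    hw.aestronglyMeasurable.mul (hcontF' r₀).aestronglyMeasurable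
  have hbound_int : Integrable bound volume := hw.norm.mul_const K
  have h_bound : ∀ᵐ t ∂volume, ∀ r ∈ ball r₀ 1, ‖F' r t‖ ≤ bound t := by
    refine Eventually.of_forall fun t r hr => ?_
    have e2 : ‖(2 : ℂ) * Real.pi * I * σ t * r‖ ≤ 2 * Real.pi * y⁻¹ * (|r₀| + 1) := by
      rw [norm_mul, norm_mul, norm_mul, norm_mul]
      simp only [Complex.norm_ofNat, Complex.norm_real, Real.norm_eq_abs,
        abs_of_pos Real.pi_pos, Complex.norm_I, mul_one]
      gcongr
      · exact hnσ t
      · exact abs_le_abs_add_one_of_mem_ball hr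
    show ‖w t * (c t * (2 * Real.pi * I * σ t * r * cexp (Real.pi * I * σ t * (r : ℂ) ^ 2)))‖ ≤
      ‖w t‖ * K
    rw [norm_mul, norm_mul, norm_mul]
    refine mul_le_mul_of_nonneg_left ?_ (norm_nonneg _)
    calc ‖c t‖ * (‖(2 : ℂ) * Real.pi * I * σ t * r‖ * ‖cexp (Real.pi * I * σ t * (r : ℂ) ^ 2)‖)
        ≤ y⁻¹ ^ ((d : ℝ) / 2) * (2 * Real.pi * y⁻¹ * (|r₀| + 1) * 1) :=
          mul_le_mul (hnc t) (mul_le_mul e2 (e1 t r) (norm_nonneg _) (by positivity))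
            (by positivity) (by positivity)
      _ = K := by simp only [hK, mul_one]
  have h_diff : ∀ᵐ t ∂volume, ∀ r ∈ ball r₀ 1, HasDerivAt (F · t) (F' r t) r := by
    refine Eventually.of_forall fun t r _ => ?_
    simp only [hF, hF']
    have h := ((hasDerivAt_cexp_quadratic (Real.pi * I * σ t) r).const_mul (c t)).const_mul (w t)
    refine h.congr_deriv ?_
    ring
  exact hasDerivAt_integral_of_dominated_loc_of_deriv_le (ball_mem_nhds r₀ one_pos)
    (Eventually.of_forall hmeas) (hint r₀) hF'meas h_bound hbound_int h_diff

/-- **Radial derivatives of `Ŝ_w`**: `Ŝ_w′(r) = ∫ w(t) (i/τ(t))^{d/2} 2πi(−1/τ(t)) r e^{πi(−1/τ(t))r²} dt`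
(differentiation under the integral sign). [cite: CohnEtAl2019, §2.3 Lemma 2.2] -/
theorem radialDeriv_fourier_gaussSup {w : ℝ → ℂ} (hw : Integrable w) {y : ℝ} (hy : 0 < y) (r : ℝ) :
    radialDeriv (𝓕 (gaussSup w y : EuclideanSpace ℝ (Fin d) → ℂ)) r =
      ∫ t : ℝ, w t * ((I / lineH y t) ^ ((d : ℂ) / 2) *
        (2 * Real.pi * I * (-(lineH y t)⁻¹) * r * cexp (Real.pi * I * (-(lineH y t)⁻¹) * (r : ℂ) ^ 2))) := by
  rw [radialDeriv_def, fourier_gaussSup_axisPt hw hy, (hasDerivAt_radial_fourier_gaussSup hw hy r).2.deriv]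

end EuclideanFourier

end Literature.Analysis.Fourier
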